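import Summits.AnomalousDissipation.AnomalousDissipation.Theorems.BaireTransferDenseLoudDesignerForcesErgodicLine
import Mathlib.MeasureTheory.Constructions.Polish.Basic
import Mathlib.MeasureTheory.Measure.SeparableMeasure

/-!
# The model measure through the smoothing isomorphism (line `ergodic-budget-selection-closing`,
# crux `BaireTransfer.DenseLoudDesignerForces`, stmt-AnomalousDissipation-1143) — tools stub of block N

Sorry-free file over the landed vocabulary `…ErgodicLine.lean` (`Hsp`, `IsInvariantMeasure`).  Block N of the line models
the Navier–Stokes semiflow `φ` on the compact core `Smap '' Λ` by `g_t := Smap⁻¹ ∘ φ_t ∘ Smap` on a neighbourhood `U` of a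
compact set `Λ ⊆ H`, where `Smap : H →L[ℝ] H` is an injective bounded (smoothing) operator.  The interfaces
`Literature.Dynamics.Hyperbolic.IsHyperbolicSemiflowModel` and `IsSmoothModelOf` (`…ErgodicModel.lean`) need a MODEL MEASURE:
a `g`-invariant Borel probability measure `m` carried by `Λ` with `(Smap)_* m = μ`.  This file constructs it as the pullback
`m := Measure.comap Smap μ`:

* `stub_modelMeasureTools_aux_image_inter` — the set identity `S '' (g ⁻¹' B ∩ Λ) = φ ⁻¹' (S '' (B ∩ Λ)) ∩ S '' Λ` for a
  conjugacy `S ∘ g = φ ∘ S` on a `g`-invariant set `Λ` and injective `S`;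
* `stub_modelMeasureTools_aux_comap_compl` — `(μ.comap S) Λᶜ = 0` when `μ (S '' Λ)ᶜ = 0` and `S` is a measurable embedding;
* `stub_modelMeasureTools_aux_map_comap` — the pullback `μ.comap S` of a `φ`-invariant measure carried by `S '' Λ` is
  `g`-invariant (generic measurable spaces, `S` a measurable embedding);
* `stub_modelMeasureTools` (the REGISTERED tools stub, proved) — on `Hsp` (a closed subspace of the separable Hilbert space
  `L²(T³; ℝ³)`, hence Polish, with its Borel σ-algebra) an injective bounded operator is a measurable embedding
  (`Continuous.measurableEmbedding`, Lusin–Souslin), so `m := μ.comap Smap` is a probability measure carried by `Λ`,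
  `g_t`-invariant for `t ≥ 0`, with `Measure.map Smap m = μ` and `m (Smap ⁻¹' s) = 0` for every `μ`-null `s`.

References: A. S. Kechris, *Classical Descriptive Set Theory* (Springer 1995), Thm 15.1 (Lusin–Souslin); C. Foias, O. Manley,
R. Rosa, R. Temam, *Navier–Stokes Equations and Turbulence* (CUP 2001), Ch. IV §2 (invariant measures).  Nothing is asserted;
no definition is added.
-/

-- `Summit.<Summit>.<Problem>` is the tree's mandated summit-side namespace (CONVENTIONS §2); for this
-- single-conjunct summit the two coincide, so the duplicate is deliberate.
set_option linter.dupNamespace false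

noncomputable section

open scoped BigOperators Topology ENNReal InnerProductSpace
open Filter Set Function MeasureTheory

namespace Summit.AnomalousDissipation.AnomalousDissipation.Theorems.DenseLoudDesignerForces.Ergodic

open Literature.Analysis.FunctionSpaces Literature.Analysis.FunctionSpaces.Torus
open Literature.Analysis.FluidPDE Literature.Analysis.FluidPDE.Torus

section ModelMeasure

/-! ## §1 Generic pullback of an invariant measure through an injective conjugacy -/

/-- The set identity behind the invariance of the pulled-back measure: if `S` is injective, `g` maps `Λ` into itself
and `S (g y) = φ (S y)` on `Λ`, then `S '' (g ⁻¹' B ∩ Λ) = φ ⁻¹' (S '' (B ∩ Λ)) ∩ S '' Λ`. [folklore] -/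
theorem stub_modelMeasureTools_aux_image_inter {X Y : Type*} {S : X → Y} (hinj : Injective S) {Λ : Set X}
    {g : X → X} {φ : Y → Y} (hmaps : MapsTo g Λ Λ) (hconj : ∀ y ∈ Λ, S (g y) = φ (S y)) (B : Set X) :
    S '' (g ⁻¹' B ∩ Λ) = φ ⁻¹' (S '' (B ∩ Λ)) ∩ S '' Λ := by
  ext x
  constructor
  · rintro ⟨y, ⟨hyB, hyΛ⟩, rfl⟩
    exact ⟨⟨g y, ⟨hyB, hmaps hyΛ⟩, hconj y hyΛ⟩, mem_image_of_mem S hyΛ⟩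
  · rintro ⟨⟨z, ⟨hzB, -⟩, hz⟩, ⟨y, hyΛ, rfl⟩⟩
    refine ⟨y, ⟨?_, hyΛ⟩, rfl⟩
    rw [← hconj y hyΛ] at hz
    rw [mem_preimage, ← hinj hz]
    exact hzB

/-- If `μ` is carried by `S '' Λ` and `S` is a measurable embedding, then the pullback `μ.comap S` is carried by `Λ`
(`S '' Λᶜ` is disjoint from `S '' Λ` by injectivity). [folklore] -/
theorem stub_modelMeasureTools_aux_comap_compl {X Y : Type*} {mX : MeasurableSpace X} {mY : MeasurableSpace Y}
    {S : X → Y} (hemb : MeasurableEmbedding S) {Λ : Set X} {μ : Measure Y} (hnull : μ (S '' Λ)ᶜ = 0) :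
    μ.comap S Λᶜ = 0 := by
  rw [hemb.comap_apply]
  refine measure_mono_null ?_ hnull
  rintro _ ⟨y, hy, rfl⟩ ⟨z, hz, hzy⟩
  exact hy (hemb.injective hzy ▸ hz)

/-- **Pullback of an invariant measure through an injective conjugacy** (generic measurable spaces).  Let `S : X → Y` be a
measurable embedding, `Λ ⊆ X` measurable, `μ` a measure on `Y` carried by `S '' Λ` and invariant under an a.e.-measurable
map `φ` (`Measure.map φ μ = μ`), and let `g : X → X`, a.e.-measurable for `μ.comap S`, map `Λ` into itself with
`S ∘ g = φ ∘ S` on `Λ`.  Then `μ.comap S` is `g`-invariant: for measurable `B`,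
`(μ.comap S) (g ⁻¹' B) = μ (S '' (g ⁻¹' B ∩ Λ)) = μ (φ ⁻¹' (S '' (B ∩ Λ))) = μ (S '' (B ∩ Λ)) = (μ.comap S) B`.
[cite: FMRTTurbulence2001, Ch. IV §2 Def. 2.1 (invariant measures)] -/
theorem stub_modelMeasureTools_aux_map_comap {X Y : Type*} {mX : MeasurableSpace X} {mY : MeasurableSpace Y}
    {S : X → Y} (hemb : MeasurableEmbedding S) {Λ : Set X} (hΛm : MeasurableSet Λ) {μ : Measure Y}
    (hnull : μ (S '' Λ)ᶜ = 0) {g : X → X} {φ : Y → Y} (hg : AEMeasurable g (μ.comap S))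
    (hmaps : MapsTo g Λ Λ) (hconj : ∀ y ∈ Λ, S (g y) = φ (S y)) (hφ : AEMeasurable φ μ)
    (hinv : Measure.map φ μ = μ) : Measure.map g (μ.comap S) = μ.comap S := by
  have hmnull : μ.comap S Λᶜ = 0 := stub_modelMeasureTools_aux_comap_compl hemb hnull
  ext B hB
  rw [Measure.map_apply_of_aemeasurable hg hB, ← measure_inter_conull hmnull, hemb.comap_apply,
    stub_modelMeasureTools_aux_image_inter hemb.injective hmaps hconj B, measure_inter_conull hnull,
    ← Measure.map_apply_of_aemeasurable hφ (hemb.measurableSet_image.2 (hB.inter hΛm)), hinv,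
    ← hemb.comap_apply, measure_inter_conull hmnull]

/-! ## §2 The registered tools stub -/

/-- **Registered tools stub of block N** (`ledger workitem` stub `stub_modelMeasureTools` of crux
stmt-AnomalousDissipation-1143, line `ergodic-budget-selection-closing`): THE MODEL MEASURE THROUGH THE SMOOTHING
ISOMORPHISM.  Let `Smap : H →L[ℝ] H` be injective, `Λ ⊆ U ⊆ H` with `U` open and `Λ` compact, `g_t` continuous on `U` and
mapping `Λ` into itself, conjugated by `Smap` to `φ_t` on `Λ` (`t ≥ 0`), and `μ` a `φ`-invariant Borel probability measure
carried by `Smap '' Λ`.  Then `m := Measure.comap Smap μ` is a Borel probability measure carried by `Λ`, `g_t`-invariant for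
`t ≥ 0`, with `Measure.map Smap m = μ`, and `m (Smap ⁻¹' s) = 0` for every `μ`-null set `s`.  Key input: `H` (a closed
subspace of the separable Hilbert space `L²(T³; ℝ³)`) is Polish, so the injective continuous `Smap` is a measurable
embedding (Lusin–Souslin: Borel images of Borel sets, Mathlib's `Continuous.measurableEmbedding`), whence
`m s = μ (Smap '' s)` for every `s` and `Measure.map Smap m = μ.restrict (range Smap) = μ`.
[cite: FMRTTurbulence2001, Ch. IV §2 Def. 2.1 (invariant measures)] -/
theorem stub_modelMeasureTools (Smap : Hsp →L[ℝ] Hsp) (hinj : Function.Injective Smap) {U Λ : Set Hsp} (hU : IsOpen U)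
    (hΛ : IsCompact Λ) (hΛU : Λ ⊆ U) {g φ : ℝ → Hsp → Hsp} (hg : ∀ t : ℝ, 0 ≤ t → ContinuousOn (g t) U)
    (hmaps : ∀ t : ℝ, 0 ≤ t → MapsTo (g t) Λ Λ) (hconj : ∀ t : ℝ, 0 ≤ t → ∀ y ∈ Λ, Smap (g t y) = φ t (Smap y))
    {μ : Measure Hsp} (hμ : IsInvariantMeasure (Smap '' Λ) φ μ) :
    ∃ m : Measure Hsp, IsProbabilityMeasure m ∧ m Λᶜ = 0 ∧ (∀ t : ℝ, 0 ≤ t → Measure.map (g t) m = m) ∧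
      Measure.map Smap m = μ ∧ ∀ s : Set Hsp, μ s = 0 → m (Smap ⁻¹' s) = 0 := by
  -- `Hsp` is Polish: a complete (closed) subspace of the separable `L²(T³; ℝ³)` (Mathlib's `Lp.SecondCountableTopology`,
  -- exponent hypothesis `2 ≠ ∞` as a `Fact`); the instances are kept local to this proof.
  haveI : Fact ((2 : ℝ≥0∞) ≠ ∞) := ⟨ENNReal.ofNat_ne_top⟩
  haveI : SecondCountableTopology Hsp := TopologicalSpace.Subtype.secondCountableTopology _
  haveI : PolishSpace Hsp := ⟨⟩
  haveI : IsProbabilityMeasure μ := hμ.prob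
  have hemb : MeasurableEmbedding Smap := Smap.continuous.measurableEmbedding hinj
  have hnull : μ (Smap '' Λ)ᶜ = 0 := hμ.null_compl
  have hmΛ : μ.comap Smap Λᶜ = 0 := stub_modelMeasureTools_aux_comap_compl hemb hnull
  have hmap : Measure.map Smap (μ.comap Smap) = μ := by
    rw [hemb.map_comap]
    refine Measure.restrict_eq_self_of_ae_mem ?_
    rw [ae_iff]
    exact measure_mono_null (fun x hx hx' => hx (image_subset_range _ _ hx')) hnull
  refine ⟨μ.comap Smap, ?_, hmΛ, fun t ht => ?_, hmap, fun s hs => ?_⟩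
  · -- probability: `Smap` pushes `μ.comap Smap` to the probability measure `μ`
    haveI : IsProbabilityMeasure (Measure.map Smap (μ.comap Smap)) := by
      rw [hmap]
      infer_instance
    exact Measure.isProbabilityMeasure_of_map Smap
  · -- invariance under `g_t`, `t ≥ 0`
    have hmU : ∀ᵐ x ∂(μ.comap Smap), x ∈ U := by
      rw [ae_iff]
      exact measure_mono_null (fun x hx hxΛ => hx (hΛU hxΛ)) hmΛ
    have hgae : AEMeasurable (g t) (μ.comap Smap) := by
      have h := (hg t ht).aemeasurable (μ := μ.comap Smap) hU.measurableSet
      rwa [Measure.restrict_eq_self_of_ae_mem hmU] at h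
    have hφae : AEMeasurable (φ t) μ := by
      refine AEMeasurable.of_map_ne_zero ?_
      rw [hμ.map_eq t ht]
      exact IsProbabilityMeasure.ne_zero μ
    exact stub_modelMeasureTools_aux_map_comap hemb hΛ.measurableSet hnull hgae (hmaps t ht) (hconj t ht) hφae
      (hμ.map_eq t ht)
  · -- `μ`-null sets pull back to null sets
    rw [hemb.comap_preimage]
    exact measure_mono_null inter_subset_left hs

end ModelMeasure

end Summit.AnomalousDissipation.AnomalousDissipation.Theorems.DenseLoudDesignerForces.Ergodic

end
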